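import Summits.FinalStateConjecture.FinalStateConjecture.Theorems.PhotonSphereChannelsTameEternalLimitDefs
import HarnessLib

/-!
# Crux `ChannelsResolveTameDevelopmentsR` (stmt-FinalStateConjecture-14075), line
# `trapped-set-observability-analyticity` — stub `stub_kappaFloor` (S2): the constant `κ₀` in
# `RedShifted κ₀` carries no scale

Audit lemma (A2/B2 of the S2 brief) over the landed vocabulary `Theorems.TrappedSet`
(`PhotonSphereChannelsTameEternalLimitDefs.lean`).  `E.RedShifted κ₀` asks for a tame renormalisation
`L' = φ L` of the clock-normalised horizon generator with constant non-affinity `∇_{L'} L' = κ₀ L'`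
on the horizon.  Rescaling the witness by a positive constant, `L'' = a L'`, gives
`∇_{L''} L'' = a² κ₀ L' = (a κ₀) L''` (linearity of the honest Levi-Civita connection in the
section, Mathlib's `IsCovariantDerivativeOn.smul_const`, and in the direction), and `a φ` is again
smooth near the horizon and pinched.  Hence `RedShifted κ₀ → RedShifted (a κ₀)` for `0 < a`
(`TameEternalLimit.RedShifted.mul_pos`) and the conclusion `∃ κ₀ > 0, E.RedShifted κ₀` of stub S2
is equivalent to `E.RedShifted 1` (`TameEternalLimit.exists_redShifted_iff_one`, registered
sub-goal `stub_redShiftedScaleFree`): the red-shift predicate records the EXISTENCE of a bounded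
renormalisation to constant positive surface gravity (exponential growth of the affine parameter in
tame time), not a value of the surface gravity — as its docstring says.
-/

set_option linter.dupNamespace false

noncomputable section

namespace Summit.FinalStateConjecture.FinalStateConjecture.Theorems.TrappedSet

open Literature.Geometry.Lorentzian
open Bundle Set Manifold
open scoped Manifold ContDiff Topology

namespace TameEternalLimit

variable {E : TameEternalLimit}

/-- On the horizon the generator field is differentiable as a section of `TZ`
(`contMDiffOn_generator`). [folklore] -/
private theorem mdifferentiableAt_generator {p : E.Z.carrier} (hp : p ∈ E.horizon) :
    MDifferentiableAt (𝓡 4) ((𝓡 4).prod 𝓘(ℝ, E4))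
      (fun x ↦ (TotalSpace.mk' E4 x (E.L x) : TangentBundle (𝓡 4) E.Z.carrier)) p := by
  obtain ⟨𝒩, h𝒩, hsub, hL⟩ := E.contMDiffOn_generator
  exact ((hL.contMDiffAt (h𝒩.mem_nhds (hsub hp))).mdifferentiableAt (by simp))

/-- **Positive rescaling of the red-shift constant.** If `E.RedShifted κ₀` (witness `φ`, pinching
constant `c`) and `0 < a`, then `E.RedShifted (a * κ₀)` (witness `a φ`, pinching constant
`max a a⁻¹ * c`): `∇_{aφL}(aφL) = a² ∇_{φL}(φL) = a² κ₀ φ L = (a κ₀)(a φ L)` on the horizon.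
[folklore] -/
theorem RedShifted.mul_pos [E.Z.metric.toPseudoRiemannianMetric.HasLeviCivita] {κ₀ : ℝ}
    (h : E.RedShifted κ₀) {a : ℝ} (ha : 0 < a) : E.RedShifted (a * κ₀) := by
  obtain ⟨φ, c, hc, ⟨𝒩, h𝒩, hsub, hφ⟩, hpinch, heq⟩ := h
  have hg : ContDiff ℝ ((⊤ : ℕ∞) : ℕ∞ω) (fun y : ℝ ↦ a * y) := contDiff_const.mul contDiff_id
  refine ⟨fun x ↦ a * φ x, max a a⁻¹ * c, by positivity,
    ⟨𝒩, h𝒩, hsub, fun x hx ↦ hg.comp_contMDiffWithinAt (hφ x hx)⟩, fun p hp ↦ ?_, fun p hp ↦ ?_⟩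
  · -- pinching of `a φ` between `(max a a⁻¹ * c)⁻¹` and `max a a⁻¹ * c`
    obtain ⟨h1, h2⟩ := hpinch p hp
    have hm : 0 < max a a⁻¹ := lt_max_of_lt_left ha
    constructor
    · calc (max a a⁻¹ * c)⁻¹ = (max a a⁻¹)⁻¹ * c⁻¹ := by rw [mul_inv]
        _ ≤ (a⁻¹)⁻¹ * c⁻¹ := by
            gcongr
            exact le_max_right _ _
        _ = a * c⁻¹ := by rw [inv_inv]
        _ ≤ a * φ p := by gcongr
    · calc a * φ p ≤ a * c := by gcongr
        _ ≤ max a a⁻¹ * c := by gcongr; exact le_max_left _ _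
  · -- the equation: linearity of `∇` in the section and in the direction
    have hφd : MDifferentiableAt (𝓡 4) 𝓘(ℝ, ℝ) φ p :=
      (hφ.contMDiffAt (h𝒩.mem_nhds (hsub hp))).mdifferentiableAt (by simp)
    have hψ : MDifferentiableAt (𝓡 4) ((𝓡 4).prod 𝓘(ℝ, E4))
        (fun x ↦ (TotalSpace.mk' E4 x (φ x • E.L x) : TangentBundle (𝓡 4) E.Z.carrier)) p :=
      hφd.smul_section (mdifferentiableAt_generator hp)
    have hsec : (fun x ↦ (a * φ x) • E.L x) = a • (fun x ↦ φ x • E.L x) := by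
      funext x
      simp only [Pi.smul_apply, mul_smul]
    have hcov := (E.Z.metric.leviCivita.isCovariantDerivativeOn (s := Set.univ)).smul_const a hψ
      (Set.mem_univ p)
    rw [hsec, hcov, _root_.smul_apply, mul_smul, map_smul, heq p hp]
    simp only [smul_smul]
    ring_nf

/-- **The red-shift constant is scale-free**: `∃ κ₀ > 0, E.RedShifted κ₀ ↔ E.RedShifted 1`.
[folklore] -/
theorem exists_redShifted_iff_one [E.Z.metric.toPseudoRiemannianMetric.HasLeviCivita] :
    (∃ κ₀ : ℝ, 0 < κ₀ ∧ E.RedShifted κ₀) ↔ E.RedShifted 1 := by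
  constructor
  · rintro ⟨κ₀, hκ₀, h⟩
    have h' := h.mul_pos (inv_pos.mpr hκ₀)
    rwa [inv_mul_cancel₀ hκ₀.ne'] at h'
  · intro h
    exact ⟨1, one_pos, h⟩

end TameEternalLimit

/-- Registered sub-goal `stub_redShiftedScaleFree` (closed form of
`TameEternalLimit.RedShifted.mul_pos` and `TameEternalLimit.exists_redShifted_iff_one`): the
conclusion of S2 is equivalent to `E.RedShifted 1`. [folklore] -/
theorem stub_redShiftedScaleFree :
    ∀ (E : TameEternalLimit) [E.Z.metric.toPseudoRiemannianMetric.HasLeviCivita],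
      (∀ κ₀ a : ℝ, 0 < a → E.RedShifted κ₀ → E.RedShifted (a * κ₀)) ∧
      ((∃ κ₀ : ℝ, 0 < κ₀ ∧ E.RedShifted κ₀) ↔ E.RedShifted 1) :=
  fun _ _ ↦ ⟨fun _ _ ha h ↦ h.mul_pos ha, TameEternalLimit.exists_redShifted_iff_one⟩

end Summit.FinalStateConjecture.FinalStateConjecture.Theorems.TrappedSet

end
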